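import Summits.QuantumFields.YangMills.Theorems.ConvexGribovBodyNonSimplyConnectedLatticeGapStubCorrPullbackCover
import Summits.QuantumFields.YangMills.Theorems.IR.Negative.OnsetUcSCHomFalseOfMonopoleWire
import Summits.QuantumFields.YangMills.Theorems.IR.AfPincerUcFormat
import Summits.QuantumFields.YangMills.Theorems.IR.AfPincerUcSharpOnset
import Summits.QuantumFields.YangMills.Theorems.IR.Negative.OnsetUcSCHomFalseOfMonopoleWireCover
import Summits.QuantumFields.YangMills.Theorems.BalabanLadderIRColdPressurePincer

/-! # Crux workfile `Cruxes/IR/CentreCoverPullback.lean` — rev 4 (planner `ym-cruxidea-19354-1` g14, editions part 1 v4 ∕ part 2 v5, 2026-08-27)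
SINGLE-FILE EDITION of the Theorems-home PAIR prepared for the courier (filed there only on the route OWNER's word, R97∕R101):
part 1 = `Theorems/IR/CentreCoverPullbackTransport.lean` (§0–§2, the covering transport; HOME `CentreCoverPullbackTransport.v4.lean`,
unchanged since rev 3), part 2 = `Theorems/IR/CentreCoverPullback.lean` (§3⁰ junction lemmas, §3 the statements `IRCentreBlindNSC` ∕
`IRCentreBlind` and the compositions, §4 the check against the superseded slot d9d9d710e4ae01bd, §4♯ the check against the slot OF
RECORD; HOME `CentreCoverPullback.v5.lean`; in the tree part 2 imports part 1 — here the two bodies follow each other and part 2's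
`import …Theorems.IR.CentreCoverPullbackTransport` is dropped).  rev 4 versus rev 3 (commit 467f9916a898 = part 1 v4 + part 2 v4): the
route owner RE-CUT the registered skeleton of this crux to «sharp merge I♯_SC» (`line-af-pincer-Uc.sharp.reg.lean`, sha16
28967a1bf60ad397, ruling R104 ∕ REGISTRY WRITE #8, 2026-08-27T13:00:44Z): namespace `…Cruxes.IR.AfPincerUcSharp`, stubs
`stub_onsetSharpSC : AfPincerUc.SharpOnset.OnsetSharpUKPcSC` (the one load-bearing open stub, simply connected family) and the residual
`stub_irNSC : AfPincerUc.SharpOnset.IRNSC` (unstaffed, R101; a tree constant since p532238), composition `IR_of_sharp`.  Part 2 v5 adds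
§4♯ in the SUB-namespace `…AfPincerUcSharp.CentreCover` — `irNSC_iff_irnsc : AfPincerUc.SharpOnset.IRNSC ↔ ColdPressurePincer.IRnsc`
(`Iff.rfl`), `stub_irNSC_of_centreCover : IRCentreBlindNSC → AfPincerUc.SharpOnset.IRNSC` (the registered residual BY NAME from the
centre-blind clause alone) and `IR_of_sharpSC_centreCover : OnsetSharpUKPcSC → IRCentreBlindNSC → Theses.BalabanLadder.IR` (through the
landed `SharpOnset.ir_of_onsetSharpSC`, p532238) — and imports `Theorems.IR.AfPincerUcSharpOnset`; EVERY other declaration (part 1,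
§3⁰, §3, §4) is BYTE-IDENTICAL to rev 3 (certideate-1's junction target `IRCentreBlindNSC` and `ym-cruxidea-19354-nsc`'s last arrow
`irnsc_of_centreBlindNSC` — cited by nsc g0 under its rev-1 name `irNSC_of_centreBlindNSC'` — are unaffected). -/



/-!
# Covering transport of the crux-`BalabanLadder.IR` vocabulary (`LowerBounds`, `GapInUnits`) along `π : H →* G`
Helper module for crux `BalabanLadder.IR` (stmt-QuantumFields-19354), part 1 of 2 of the Theorems-home edition of the
crux workfile `Cruxes/IR/CentreCoverPullback.lean` (rev 2, commit eebcfa1d71f7; crux idea `Cruxes/IR/Ideas/centre-cover-pullback.md`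
+ addendum `…-addendum-g13.md`); part 2 is `Theorems/IR/CentreCoverPullback.lean` (the junction lemmas `lowerBounds_iff` ∕
`gapInUnits_iff`, the statements `IRCentreBlindNSC`, `IRCentreBlind` and the compositions concluding the route decl via the
landed `ColdPressurePincer.IRnsc` ∕ `IR_of_cases`).  Author: planner `ym-cruxidea-19354-1`; filed only on the route owner's
word (ym-beyond-p2 R97∕R101).  Edition v4 (2026-08-27): v3 minus the direct import of
`Theorems.LangevinControlUVOSLegsFromFemtoAndGapDefs` (a module that itself imports the route file `Theses.LangevinControlUV`;
gate lint `theses-cone`, courier preflight 2026-08-27T12:45Z) — the only two declarations needing it, `lowerBounds_iff` and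
`gapInUnits_iff`, moved VERBATIM to part 2; every other statement byte-identical to v3.  The import closure of this part now
reaches no route file and no `Statement` module (route-independent in the strong, transitive sense).

CONTENT.  For a continuous surjective homomorphism `π : H →* G` of compact groups and a continuous matrix representation
`ρ` of `G`, Wilson's measure of `(H, ρ ∘ π)` pushes forward under the link-wise lift `W ↦ π ∘ W` to Wilson's measure of
`(G, ρ)` — LANDED for crux 16405 (`NonSimplyConnectedLatticeGap.map_wilsonMeasure_comp_of_surjective`,
`integral_wilsonMeasure_comp_of_surjective`, `stub_corrPullbackCover`) and CITED BY NAME; the link-wise lift on `ℤ⁴` and its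
measurability are the landed `OnsetFormatsUc.coverLift`, `plaquetteHolonomyZd_coverLift`, `measurable_coverLift` (p529536),
also cited by name.  New here is only the transport of the crux-19354 vocabulary: §0 the `ρ`-versions `densR`, `torusER`,
`torusK3R`, `Q2R`, `Q3R`, `LowerBoundsR`, `GapInUnitsR` of the tree's `dens`, `torusE`, `torusK3`, `Q2`, `Q3`, `LowerBounds`,
`GapInUnits` (`Cruxes.OSLegsFromFemtoAndGap.DlrCollarTransfer`, which take a faithful `LatticeRep`; at a `LatticeRep` the two
agree by `Iff.rfl` — part 2's `lowerBounds_iff`, `gapInUnits_iff`), §1 the algebra of the lift (`actionDensity_comp`, `configShift_coverLift`, `densR_comp`), §2 the transport: the crux HYPOTHESIS is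
INVARIANT (`lowerBoundsR_comp_iff`) and the crux CONCLUSION DESCENDS along `π` with the same constants (`gapInUnitsR_of_comp`,
via the pull-back `comapObs` of local gauge-invariant observables).

Farm `lean check`: rc 0, no `sorry`, axioms `[propext, Classical.choice, Quot.sound]`.
HONEST FRAMING: exact identities plus bookkeeping; the analytic content of the crux is not touched; nothing here is
progress on the gap or on Clay.
-/

set_option autoImplicit false

noncomputable section

open Filter Topology MeasureTheory
open scoped SchwartzMap ENNReal
open Literature.MathematicalPhysics.QuantumFieldTheory Literature.MathematicalPhysics.QuantumLattice
open Literature.Probability.LatticeModels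
open Summit.QuantumFields.YangMills.Cruxes.IR.OnsetFormatsUc (coverLift plaquetteHolonomyZd_coverLift measurable_coverLift)

namespace Summit.QuantumFields.YangMills.Cruxes.IR.CentreCover

/-! ## §0 The crux vocabulary for a bare (not necessarily faithful) representation `ρ` -/

section RhoVersions

variable (G : Type) [Group G] [TopologicalSpace G] [IsTopologicalGroup G] [CompactSpace G]
  [MeasurableSpace G] [BorelSpace G] {N : ℕ} (ρ : G →* Matrix (Fin N) (Fin N) ℂ) (a : ℝ → ℝ)

/-- The action density of `ρ` at the site `x` (tree `dens` with `r.curvature.F = actionDensity r.ρ`). -/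
def densR (x : Fin 4 → ℤ) (U : LGConfig 4 G) : ℝ :=
  actionDensity ρ (configShift (-x) U)

/-- Torus expectation under Wilson's measure of `ρ` on the torus of side `2L+1` (tree `torusE`). -/
def torusER (β : ℝ) (L : ℕ) (F : LGConfig 4 G → ℝ) : ℝ :=
  ∫ U, F (torusLift (2 * L + 1) U) ∂(wilsonMeasure (d := 4) (L := 2 * L + 1) ρ β)

/-- Torus third cumulant of the action densities (tree `torusK3`). -/
def torusK3R (β : ℝ) (L : ℕ) (x y z : Fin 4 → ℤ) : ℝ :=
  torusER G ρ β L (fun U => densR G ρ x U * densR G ρ y U * densR G ρ z U)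
    - torusER G ρ β L (densR G ρ x) * torusER G ρ β L (fun U => densR G ρ y U * densR G ρ z U)
    - torusER G ρ β L (densR G ρ y) * torusER G ρ β L (fun U => densR G ρ x U * densR G ρ z U)
    - torusER G ρ β L (densR G ρ z) * torusER G ρ β L (fun U => densR G ρ x U * densR G ρ y U)
    + 2 * (torusER G ρ β L (densR G ρ x) * torusER G ρ β L (densR G ρ y) * torusER G ρ β L (densR G ρ z))

/-- Bare smeared truncated two-point function (tree `Q2`). -/
def Q2R (β : ℝ) (L : ℕ) (s : ℝ) (f g : 𝓢(EuclideanSpace ℝ (Fin 4), ℝ)) : ℝ :=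
  ∑ x ∈ box 4 L, ∑ y ∈ box 4 L, f (s • siteToE x) * g (s • siteToE y) *
    (torusER G ρ β L (fun U => densR G ρ x U * densR G ρ y U) - torusER G ρ β L (densR G ρ x) * torusER G ρ β L (densR G ρ y))

/-- Bare smeared connected three-point function (tree `Q3`). -/
def Q3R (β : ℝ) (L : ℕ) (s : ℝ) (f g h : 𝓢(EuclideanSpace ℝ (Fin 4), ℝ)) : ℝ :=
  ∑ x ∈ box 4 L, ∑ y ∈ box 4 L, ∑ z ∈ box 4 L, f (s • siteToE x) * g (s • siteToE y) * h (s • siteToE z) *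
    torusK3R G ρ β L x y z

/-- `LowerBounds` for a bare representation (tree `LowerBounds` verbatim with `r.ρ ↦ ρ`). -/
def LowerBoundsR : Prop :=
  (∃ (v : 𝓢(EuclideanSpace ℝ (Fin 4), ℝ)) (ε β₅ Λ₅ : ℝ), tsupport v ⊆ {y : EuclideanSpace ℝ (Fin 4) | 0 < y 0} ∧ 0 < ε ∧ ∀ β : ℝ, β₅ ≤ β → ∀ L : ℕ, Λ₅ ≤ a β * L → ε ≤ Q2R G ρ β L (a β) (thetaTest 4 v) v) ∧
  (∃ (f g h : 𝓢(EuclideanSpace ℝ (Fin 4), ℝ)) (ε β₅ Λ₅ : ℝ), Disjoint (tsupport f) (tsupport g) ∧ Disjoint (tsupport g) (tsupport h) ∧ Disjoint (tsupport f) (tsupport h) ∧ 0 < ε ∧ ∀ β : ℝ, β₅ ≤ β → ∀ L : ℕ, Λ₅ ≤ a β * L → ε ≤ |Q3R G ρ β L (a β) f g h|)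

/-- `GapInUnits` for a bare representation (tree `GapInUnits` verbatim with `r.ρ ↦ ρ`). -/
def GapInUnitsR : Prop :=
  ∃ (c₁ β₂ : ℝ) (S₁ : ℝ → ℕ), 0 < c₁ ∧ ∀ A B : YMSpecies G, ∃ C : ℝ, ∀ β : ℝ, β₂ ≤ β → ∀ S n : ℕ, S₁ β ≤ S → n ≤ S → |latticeConnectedCorr ρ β (2 * S + 1) A.F B.F n| ≤ C * Real.exp (-(c₁ * a β * n))

-- The junction with the tree's `LowerBounds` ∕ `GapInUnits` (`lowerBounds_iff`, `gapInUnits_iff`, both `Iff.rfl` at a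
-- `LatticeRep`) lives in part 2 (`Theorems/IR/CentreCoverPullback.lean`), which sits in the route's own import cone anyway
-- (it concludes the route decl); this module's import closure thereby contains NO route file (`Theses.*`) and NO
-- `Statement` module at all (15 `Summits` modules, all route-free; gate lint `theses-cone`, edition v4).

end RhoVersions

/-! ## §1 The algebra of the link-wise lift `coverLift π : LGConfig d H → LGConfig d G` (landed, `OnsetFormatsUc`) -/

section Lift

variable {G : Type} [Group G] {H : Type} [Group H] (π : H →* G) {N : ℕ} (ρ : G →* Matrix (Fin N) (Fin N) ℂ)

/-- The action density of the pulled-back representation `ρ ∘ π` is the action density of `ρ` after the lift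
(plaquette holonomies are mapped by `π`: tree `plaquetteHolonomyZd_coverLift`). [folklore] -/
theorem actionDensity_comp (W : LGConfig 4 H) : actionDensity (ρ.comp π) W = actionDensity ρ (coverLift π W) := by
  simp only [actionDensity, plaquetteObs, MonoidHom.coe_comp, Function.comp_apply, plaquetteHolonomyZd_coverLift]

variable [MeasurableSpace G] [MeasurableSpace H]

/-- Lattice translations commute with the link-wise lift. [folklore] -/
theorem configShift_coverLift {d : ℕ} (v : Site d) (W : LGConfig d H) :
    configShift v (coverLift π W) = coverLift π (configShift v W) := by
  funext e; simp only [Literature.MathematicalPhysics.QuantumLattice.configShift_apply, coverLift]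

/-- The shifted action densities of `(H, ρ ∘ π)` are those of `(G, ρ)` pulled back along the lift. [folklore] -/
theorem densR_comp [TopologicalSpace G] [IsTopologicalGroup G] [CompactSpace G] [BorelSpace G]
    [TopologicalSpace H] [IsTopologicalGroup H] [CompactSpace H] [BorelSpace H] (x : Fin 4 → ℤ) :
    densR H (ρ.comp π) x = densR G ρ x ∘ coverLift π := by
  funext W; simp only [densR, Function.comp_apply, actionDensity_comp, configShift_coverLift]

end Lift

/-! ## §2 The measure transport (covering transport; generalises the tree's iso-transport
`Theorems/BalabanLadderUVOtherGroups*.lean` from `≃ₜ*` to continuous surjections — the push-forward itself is crux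
16405's landed `map_wilsonMeasure_comp_of_surjective` ∕ `integral_wilsonMeasure_comp_of_surjective` ∕ `stub_corrPullbackCover`) -/

section Transport

variable {G : Type} [Group G] [TopologicalSpace G] [IsTopologicalGroup G] [CompactSpace G]
  [MeasurableSpace G] [BorelSpace G] [SecondCountableTopology G]
  {H : Type} [Group H] [TopologicalSpace H] [IsTopologicalGroup H] [CompactSpace H]
  [MeasurableSpace H] [BorelSpace H]
  (π : H →* G) (hπ : Continuous π) (hπs : Function.Surjective π)
  {N : ℕ} (ρ : G →* Matrix (Fin N) (Fin N) ℂ) (hρ : Continuous ρ)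

include hπ hπs hρ in
/-- Torus expectations of pulled-back measurable observables agree (tree `integral_wilsonMeasure_comp_of_surjective`,
BY NAME). -/
theorem torusER_comp (β : ℝ) (L : ℕ) (F : LGConfig 4 G → ℝ) (hF : Measurable F) :
    torusER H (ρ.comp π) β L (F ∘ coverLift π) = torusER G ρ β L F := by
  have hF' : Measurable fun U : GaugeConfig 4 (2 * L + 1) G => F (torusLift (2 * L + 1) U) :=
    hF.comp (measurable_torusLift _)
  simp only [torusER, Function.comp_apply]
  -- `coverLift π (torusLift (2L+1) V)` is `torusLift (2L+1) (fun e => π (V e))` definitionally (`exact` unfolds)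
  exact Summit.QuantumFields.YangMills.Theorems.NonSimplyConnectedLatticeGap.integral_wilsonMeasure_comp_of_surjective
    π hπ hπs ρ hρ β hF'

include hπ hπs hρ in
/-- `Q2` is invariant under the covering transport (all arguments). -/
theorem Q2R_comp (β : ℝ) (L : ℕ) (s : ℝ) (f g : 𝓢(EuclideanSpace ℝ (Fin 4), ℝ)) :
    Q2R H (ρ.comp π) β L s f g = Q2R G ρ β L s f g := by
  have hd : ∀ x, Measurable (densR G ρ x) := fun x =>
    (continuous_actionDensity hρ).measurable.comp
      (Literature.MathematicalPhysics.QuantumLattice.configShift (-x)).measurable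
  have h1 : ∀ x y, torusER H (ρ.comp π) β L (fun U => densR H (ρ.comp π) x U * densR H (ρ.comp π) y U) =
      torusER G ρ β L (fun U => densR G ρ x U * densR G ρ y U) := fun x y => by
    simpa only [densR_comp π ρ, Function.comp_def] using
      torusER_comp π hπ hπs ρ hρ β L (fun U => densR G ρ x U * densR G ρ y U) ((hd x).mul (hd y))
  have h2 : ∀ x, torusER H (ρ.comp π) β L (densR H (ρ.comp π) x) = torusER G ρ β L (densR G ρ x) := fun x => by
    simpa only [densR_comp π ρ, Function.comp_def] using torusER_comp π hπ hπs ρ hρ β L (densR G ρ x) (hd x)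
  simp only [Q2R, h1, h2]

include hπ hπs hρ in
/-- `Q3` is invariant under the covering transport (all arguments). -/
theorem Q3R_comp (β : ℝ) (L : ℕ) (s : ℝ) (f g h : 𝓢(EuclideanSpace ℝ (Fin 4), ℝ)) :
    Q3R H (ρ.comp π) β L s f g h = Q3R G ρ β L s f g h := by
  have hd : ∀ x, Measurable (densR G ρ x) := fun x =>
    (continuous_actionDensity hρ).measurable.comp
      (Literature.MathematicalPhysics.QuantumLattice.configShift (-x)).measurable
  have h1 : ∀ x y, torusER H (ρ.comp π) β L (fun U => densR H (ρ.comp π) x U * densR H (ρ.comp π) y U) =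
      torusER G ρ β L (fun U => densR G ρ x U * densR G ρ y U) := fun x y => by
    simpa only [densR_comp π ρ, Function.comp_def] using
      torusER_comp π hπ hπs ρ hρ β L (fun U => densR G ρ x U * densR G ρ y U) ((hd x).mul (hd y))
  have h2 : ∀ x, torusER H (ρ.comp π) β L (densR H (ρ.comp π) x) = torusER G ρ β L (densR G ρ x) := fun x => by
    simpa only [densR_comp π ρ, Function.comp_def] using torusER_comp π hπ hπs ρ hρ β L (densR G ρ x) (hd x)
  have h3 : ∀ x y z, torusER H (ρ.comp π) β L
      (fun U => densR H (ρ.comp π) x U * densR H (ρ.comp π) y U * densR H (ρ.comp π) z U) =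
      torusER G ρ β L (fun U => densR G ρ x U * densR G ρ y U * densR G ρ z U) := fun x y z => by
    simpa only [densR_comp π ρ, Function.comp_def] using
      torusER_comp π hπ hπs ρ hρ β L (fun U => densR G ρ x U * densR G ρ y U * densR G ρ z U)
        (((hd x).mul (hd y)).mul (hd z))
  simp only [Q3R, torusK3R, h1, h2, h3]

include hπ hπs hρ in
/-- **The crux HYPOTHESIS is invariant under the covering transport.** -/
theorem lowerBoundsR_comp_iff (a : ℝ → ℝ) : LowerBoundsR H (ρ.comp π) a ↔ LowerBoundsR G ρ a := by
  simp only [LowerBoundsR, Q2R_comp π hπ hπs ρ hρ, Q3R_comp π hπ hπs ρ hρ]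

include hπ hπs hρ in
/-- Connected torus correlations of pulled-back measurable observables agree (tree `stub_corrPullbackCover`, crux 16405
K1, BY NAME). -/
theorem latticeConnectedCorr_comp (β : ℝ) (S : ℕ) [NeZero S] (A B : LGConfig 4 G → ℝ)
    (hA : Measurable A) (hB : Measurable B) (n : ℕ) :
    latticeConnectedCorr (ρ.comp π) β S (A ∘ coverLift π) (B ∘ coverLift π) n = latticeConnectedCorr ρ β S A B n :=
  Summit.QuantumFields.YangMills.Theorems.NonSimplyConnectedLatticeGap.stub_corrPullbackCover
    G H π hπ hπs N ρ hρ β S A B hA hB n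

/-- Pull-back of a local gauge-invariant observable of the `G`-theory to the `H`-theory along `π`
(same support; gauge transformations of `H` lift those of `G`). -/
def comapObs (hπ : Continuous π) (A : LocalGaugeObservable 4 G) : LocalGaugeObservable 4 H where
  F := A.F ∘ coverLift π
  supp := A.supp
  isCylinder := fun X Y h => A.isCylinder fun e he => by
    show π (X e) = π (Y e)
    rw [h e he]
  gaugeInvariant := fun g X => by
    have : coverLift π (gaugeTransformZd g X) = gaugeTransformZd (fun x => π (g x)) (coverLift π X) := by
      funext e; simp only [coverLift, gaugeTransformZd, map_mul, map_inv]
    simp only [Function.comp_apply, this]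
    exact A.gaugeInvariant _ _
  bounded := A.bounded.imp fun C hC X => hC _
  measurable := A.measurable.comp (measurable_coverLift π hπ)

include hπ hπs hρ in
/-- **The crux CONCLUSION transports DOWN the cover** (same constants `c₁, β₂, S₁`; the constant `C` of a pair of
species `A, B` of the `G`-theory is that of the pulled-back pair `comapObs π A, comapObs π B`). -/
theorem gapInUnitsR_of_comp (a : ℝ → ℝ) (h : GapInUnitsR H (ρ.comp π) a) : GapInUnitsR G ρ a := by
  obtain ⟨c₁, β₂, S₁, hc₁, h⟩ := h
  refine ⟨c₁, β₂, S₁, hc₁, fun A B => ?_⟩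
  obtain ⟨C, hC⟩ := h (comapObs π hπ A) (comapObs π hπ B)
  refine ⟨C, fun β hβ S n hS hn => ?_⟩
  have := hC β hβ S n hS hn
  rwa [show (comapObs π hπ A).F = A.F ∘ coverLift π from rfl, show (comapObs π hπ B).F = B.F ∘ coverLift π from rfl,
    latticeConnectedCorr_comp π hπ hπs ρ hρ β (2 * S + 1) A.F B.F A.measurable B.measurable n] at this

end Transport

end Summit.QuantumFields.YangMills.Cruxes.IR.CentreCover

end

/-!
# Centre-cover pullback of the non-simply-connected half `IRnsc` of crux `BalabanLadder.IR`
Helper module for crux `BalabanLadder.IR` (stmt-QuantumFields-19354), part 2 of 2 of the Theorems-home edition of the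
crux workfile `Cruxes/IR/CentreCoverPullback.lean` (rev 2, commit eebcfa1d71f7; crux idea `Cruxes/IR/Ideas/centre-cover-pullback.md`
+ addendum `…-addendum-g13.md`; part 1 = `Theorems/IR/CentreCoverPullbackTransport.lean`, the covering transport).  Author:
planner `ym-cruxidea-19354-1`; filed only on the route owner's word (ym-beyond-p2 R97∕R101: «ASSET, NO LANE, shared (T𝒜)
target»).  Edition v5 (2026-08-27): v4 plus §4♯ = the slot check RE-TARGETED to the slot of record «sharp merge
I♯_SC» (`line-af-pincer-Uc.sharp.reg.lean`, sha16 28967a1bf60ad397, owner ruling R104 ∕ REGISTRY WRITE #8; stubs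
`stub_onsetSharpSC : AfPincerUc.SharpOnset.OnsetSharpUKPcSC` (open, load-bearing, simply connected family) and the residual
`stub_irNSC : AfPincerUc.SharpOnset.IRNSC` (unstaffed, R101)): `AfPincerUcSharp.CentreCover.irNSC_iff_irnsc` (`Iff.rfl`:
the residual's tree constant IS `ColdPressurePincer.IRnsc`), `stub_irNSC_of_centreCover : IRCentreBlindNSC →
AfPincerUc.SharpOnset.IRNSC` (the registered residual BY NAME, from the centre-blind clause alone) and
`IR_of_sharpSC_centreCover : OnsetSharpUKPcSC → IRCentreBlindNSC → Theses.BalabanLadder.IR` through the landed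
`AfPincerUc.SharpOnset.ir_of_onsetSharpSC` (p532238, E discharged by p524017); hence part 2 now imports
`Theorems.IR.AfPincerUcSharpOnset` (which imports `…AfPincerUcTypCriterion`).  v4 = v3 plus §3⁰ (the two junction lemmas
`lowerBounds_iff` ∕ `gapInUnits_iff` moved VERBATIM from part 1, gate lint `theses-cone` on part 1's direct import of
`…OSLegsFromFemtoAndGapDefs`); §3⁰, §3 and §4 are BYTE-IDENTICAL to v4 (§4 = the check against the SUPERSEDED slot
d9d9d710e4ae01bd, whose pair I_SC ∧ X^{Uc} is now a documented supplier route of I♯_SC via `onsetSharpSC_of_onsetSC_af`).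
WHY A THEOREMS MODULE: the NSC-residual desks (certideate-1 (α) «(T𝒜)», `ym-cruxidea-19354-nsc`) need to IMPORT the ONE
shared target `CentreCover.IRCentreBlindNSC` by name; `Cruxes/` workfiles are outside the farm snapshots.  The slot of
record (28967a1bf60ad397; superseded d9d9d710e4ae01bd) is untouched; nothing is declared in the slot namespaces
`…Cruxes.IR.AfPincerUcSharp` ∕ `…Cruxes.IR.AfPincerUc` themselves (owner's rule) — §4♯ lives in the SUB-namespace
`…AfPincerUcSharp.CentreCover`, §4 in `…AfPincerUc.CentreCover`, §3⁰∕§3 in `…Cruxes.IR.CentreCover`.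
CITED BY NAME, not restated: the crux split by `π₁` — `ColdPressurePincer.IRsc`, `ColdPressurePincer.IRnsc` (= the slot's
residual stub `stub_irNSC`, statement verbatim) and `ColdPressurePincer.IR_of_cases : IRsc → IRnsc → IR`
(`Theorems/BalabanLadderIRColdPressurePincer{Defs,}.lean`); the sharp slot's constants and glue — `AfPincerUc.SharpOnset.IRNSC`,
`OnsetSharpUKPcSC`, `ir_of_onsetSharpSC : OnsetSharpUKPcSC → IRNSC → IR` (`Theorems/IR/AfPincerUcSharpOnset.lean`, p532238);
the universal cover in admissible shape —
`OnsetFormatsUc.admissibleCover_holds` (`Theorems/IR/Negative/OnsetUcSCHomFalseOfMonopoleWireCover.lean`, p530676).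

THE LEVER.  By part 1 the crux HYPOTHESIS `LowerBounds` is invariant and the CONCLUSION `GapInUnits` descends along a
continuous surjective homomorphism `π : H →* G` of compact groups (`CentreCover.lowerBoundsR_comp_iff`,
`gapInUnitsR_of_comp`).  With `H ↠ G` the universal cover of a non-simply-connected compact simple Lie group `G` — a THEOREM
of the tree: Weyl's covering theorem `Literature.…CompactSemisimpleUniversalCover_holds` in the cover shape of crux 16405's
landed `NonSimplyConnectedLatticeGap.stub_universalCover_of_cover`, packaged as p529536's `AdmissibleCover` and discharged
by p530676's `admissibleCover_holds` — the half `IRnsc` follows from, indeed is equivalent to, the crux's clause for SIMPLY CONNECTED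
groups and CENTRE-BLIND (non-faithful) continuous unitary representations: `irnsc_of_centreBlindNSC : IRCentreBlindNSC → IRnsc`
(§3, hypothesis-free).  Also §3: `irsc_of_centreBlind`, `IR_of_centreBlind : IRCentreBlind → IR` (the SC∕NSC split dissolves
into ONE clause over simply connected groups and ALL continuous unitary representations), and §4 (slot check):
`stub_irNSC_of_centreCover` (the slot's residual stub, statement verbatim, from `IRCentreBlindNSC` alone), `irsc_of_pincerUcSC`
(the owner's SC branch: `I^c_SC → X^c → IRsc`, with `E^c` = landed p524017) and
`IR_of_pincerUcSC_centreCover : I^c_SC → X^c → IRCentreBlindNSC → Theses.BalabanLadder.IR`; and §4♯ (check against the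
slot OF RECORD): `irNSC_iff_irnsc`, `stub_irNSC_of_centreCover : IRCentreBlindNSC → AfPincerUc.SharpOnset.IRNSC`,
`IR_of_sharpSC_centreCover : I♯_SC → IRCentreBlindNSC → Theses.BalabanLadder.IR`.

WHERE THE CONTENT WENT (negative edges of record).  Modulo the tree's `MonopoleWire` (p521601) the centre-blind onset
FORMATS are false — `OnsetFormatsUc.not_onsetMixingTypicalUKPcSCBlind_of_monopoleWire`,
`not_onsetMixingTypicalUKPcSCHom_of_monopoleWire` (p529536), unconditionally so by p530676 (`…_of_monopoleWire'`) — so no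
onset-format (`af-pincer-Uc`-type) line reaches `IRCentreBlindNSC` or
`IRCentreBlind`: faithfulness must enter ANALYTICALLY, and these targets are for GOOD-conditional ∕ defect-relativised lines
((T𝒜)) only.  The statements `IRCentreBlindNSC`, `IRCentreBlind` themselves are not refuted (they are implied by ∕
equivalent to clauses of the crux).

Farm `lean check`: rc 0, no `sorry`, axioms `[propext, Classical.choice, Quot.sound]`.  Dedup hygiene: no landed
declaration is re-declared (the `π₁`-split and the cover are cited by name; the second countability of `G` is inlined at
its single use).
HONEST FRAMING: a typed REDUCTION of the unstaffed half `IRnsc` to a statement over simply connected groups — an exact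
identity plus bookkeeping; the analytic content is NOT touched; nothing here is progress on the gap or on Clay.
-/

set_option autoImplicit false

noncomputable section

open Filter Topology MeasureTheory
open Literature.MathematicalPhysics.QuantumFieldTheory Literature.MathematicalPhysics.QuantumLattice
open Summit.QuantumFields.YangMills.Cruxes.OSLegsFromFemtoAndGap.DlrCollarTransfer (GapInUnits LowerBounds)
open Summit.QuantumFields.YangMills.Cruxes.IR.ColdPressurePincer (IRsc IRnsc IR_of_cases)

namespace Summit.QuantumFields.YangMills.Cruxes.IR.CentreCover

/-! ## §3⁰ Junction with the tree's crux vocabulary (moved here VERBATIM from part 1, edition v4)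
At a `LatticeRep` the bare `ρ`-versions of part 1 ARE the tree's `LowerBounds` ∕ `GapInUnits`
(`Cruxes.OSLegsFromFemtoAndGap.DlrCollarTransfer`, the vocabulary of the route decl `BalabanLadder.IR`) by definitional
unfolding.  They live in this part because their right-hand sides need the module
`Theorems.LangevinControlUVOSLegsFromFemtoAndGapDefs` (which imports the route file `Theses.LangevinControlUV`); this part
reaches it through the route's own import cone (`Theorems.IR.AfPincerUcFormat` → `Theses.BalabanLadder` → `Theorems.Y2BridgeClay`
→ `Theorems.Y2BridgeKing` → that module), while part 1 v4's import closure contains no route file and no `Statement` module at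
all (the condition the gate lint `theses-cone` flagged on part 1 v3 is gone in the strong, transitive sense).  This part, by
contrast, necessarily sits in the cone of `Theses.BalabanLadder` — it concludes the route decl — and thereby of
`Theses.LangevinControlUV`, because the route decl `BalabanLadder.IR` is itself stated over `DlrCollarTransfer.LowerBounds` ∕
`GapInUnits`; its two depth-1 edges (`Theorems.IR.AfPincerUcFormat`, `Theorems.BalabanLadderIRColdPressurePincer` → `Theses.BalabanLadder`)
are to the item's OWN route file. -/

section Junction

variable (G : Type) [Group G] [TopologicalSpace G] [IsTopologicalGroup G] [CompactSpace G]
  [MeasurableSpace G] [BorelSpace G] (a : ℝ → ℝ)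

/-- At a lattice representation the bare versions ARE the tree's (definitional unfolding). -/
theorem lowerBounds_iff (r : LatticeRep G) : LowerBounds G r a ↔ LowerBoundsR G r.ρ a := Iff.rfl

/-- At a lattice representation the bare versions ARE the tree's (definitional unfolding). -/
theorem gapInUnits_iff (r : LatticeRep G) : GapInUnits G r a ↔ GapInUnitsR G r.ρ a := Iff.rfl

end Junction

/-! ## §3 The statements and the compositions -/

/-- **IRCentreBlindNSC** (the transferred half, C⁺): the crux's clause for SIMPLY CONNECTED compact simple
Lie groups `H` and continuous unitary representations `ρ` that are NOT faithful (centre-blind: `ker ρ` is then a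
non-trivial finite central subgroup, or `ρ` is trivial and the clause is vacuous). -/
def IRCentreBlindNSC : Prop :=
  ∀ (H : Type) [Group H] [TopologicalSpace H] [IsTopologicalGroup H] [CompactSpace H],
    IsCompactSimpleLieGroup H → SimplyConnectedSpace H →
    letI : MeasurableSpace H := borel H; haveI : BorelSpace H := ⟨rfl⟩;
    ∀ (N : ℕ) (ρ : H →* Matrix (Fin N) (Fin N) ℂ), Continuous ρ → (∀ g, ρ g ∈ Matrix.unitaryGroup (Fin N) ℂ) →
      ¬ Function.Injective ρ →
      ∀ (a : ℝ → ℝ), (∀ β, 0 < a β) → Tendsto a atTop (𝓝 0) → LowerBoundsR H ρ a → GapInUnitsR H ρ a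

/-- **IRCentreBlind**: the crux's clause for simply connected compact simple Lie groups and ALL continuous
unitary representations (faithful or not) — the form into which the SC/NSC split dissolves. -/
def IRCentreBlind : Prop :=
  ∀ (H : Type) [Group H] [TopologicalSpace H] [IsTopologicalGroup H] [CompactSpace H],
    IsCompactSimpleLieGroup H → SimplyConnectedSpace H →
    letI : MeasurableSpace H := borel H; haveI : BorelSpace H := ⟨rfl⟩;
    ∀ (N : ℕ) (ρ : H →* Matrix (Fin N) (Fin N) ℂ), Continuous ρ → (∀ g, ρ g ∈ Matrix.unitaryGroup (Fin N) ℂ) →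
      ∀ (a : ℝ → ℝ), (∀ β, 0 < a β) → Tendsto a atTop (𝓝 0) → LowerBoundsR H ρ a → GapInUnitsR H ρ a

/-- **The transfer, hypothesis-free: `IRnsc ⟸ IRCentreBlindNSC`.**  The universal cover `π : H ↠ G` (`H` compact simple
simply connected, `π` continuous surjective, not injective) is the tree's `OnsetFormatsUc.admissibleCover_holds` (Weyl's
`CompactSemisimpleUniversalCover_holds` through crux 16405's landed `stub_universalCover_of_cover`), BY NAME; `G` is
second countable because the faithful `r.ρ` is a closed embedding into matrices; then `LowerBounds` goes UP the cover
(`lowerBoundsR_comp_iff`), the clause is applied to the non-faithful `r.ρ ∘ π`, and `GapInUnits` comes DOWN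
(`gapInUnitsR_of_comp`). -/
theorem irnsc_of_centreBlindNSC (hcb : IRCentreBlindNSC) : IRnsc := by
  intro G _ _ _ _ hG hnsc
  letI : MeasurableSpace G := borel G
  haveI : BorelSpace G := ⟨rfl⟩
  intro r a ha ha0 hlb
  obtain ⟨H, _, _, _, _, π, hH, hscH, hπ, hπs, hπi⟩ := OnsetFormatsUc.admissibleCover_holds G hG hnsc
  letI : MeasurableSpace H := borel H
  haveI : BorelSpace H := ⟨rfl⟩
  haveI : SecondCountableTopology G :=
    (r.continuous.isClosedEmbedding r.injective).isEmbedding.secondCountableTopology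
  have hρi : ¬ Function.Injective (r.ρ.comp π) := fun h => hπi (Function.Injective.of_comp (f := r.ρ) h)
  have hlbH : LowerBoundsR H (r.ρ.comp π) a :=
    (lowerBoundsR_comp_iff π hπ hπs r.ρ r.continuous a).2 ((lowerBounds_iff G a r).1 hlb)
  have hgapH : GapInUnitsR H (r.ρ.comp π) a :=
    hcb H hH hscH r.N (r.ρ.comp π) (r.continuous.comp hπ) (fun g => r.mem_unitary (π g)) hρi a ha ha0 hlbH
  exact (gapInUnits_iff G a r).2 (gapInUnitsR_of_comp π hπ hπs r.ρ r.continuous a hgapH)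

/-- The centre-blind form implies the transferred half (drop a hypothesis). -/
theorem irCentreBlindNSC_of_centreBlind (h : IRCentreBlind) : IRCentreBlindNSC :=
  fun H _ _ _ _ hH hsc N ρ hρ hρu _ a ha ha0 hlb => h H hH hsc N ρ hρ hρu a ha ha0 hlb

/-- The centre-blind form implies the simply-connected half `IRsc` (the faithful case, definitional unfolding). -/
theorem irsc_of_centreBlind (hcb : IRCentreBlind) : IRsc := by
  intro G _ _ _ _ hG hsc
  letI : MeasurableSpace G := borel G
  haveI : BorelSpace G := ⟨rfl⟩
  intro r a ha ha0 hlb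
  exact (gapInUnits_iff G a r).2
    (hcb G hG hsc r.N r.ρ r.continuous r.mem_unitary a ha ha0 ((lowerBounds_iff G a r).1 hlb))

/-- **`IR ⟸ IRCentreBlind`, concluding the ROUTE DECL by name** — the crux is implied by its own clause restricted to
SIMPLY CONNECTED groups, extended to all (possibly non-faithful) continuous unitary representations (split: the landed
`ColdPressurePincer.IR_of_cases`).  A TARGET for GOOD-conditional ∕ defect-relativised lines only: the centre-blind
onset FORMAT toward it is false modulo `MonopoleWire` (p529536). -/
theorem IR_of_centreBlind (hcb : IRCentreBlind) : Summit.QuantumFields.YangMills.Theses.BalabanLadder.IR :=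
  IR_of_cases (irsc_of_centreBlind hcb) (irnsc_of_centreBlindNSC (irCentreBlindNSC_of_centreBlind hcb))

end Summit.QuantumFields.YangMills.Cruxes.IR.CentreCover

/-! ## §4 Slot check against the SUPERSEDED skeleton `af-pincer-Uc` (d9d9d710e4ae01bd; history since R104 — its pair
I_SC ∧ X^{Uc} is a documented SUPPLIER ROUTE of the slot of record's I♯_SC, `SharpOnset.onsetSharpSC_of_onsetSC_af`):
the residual stub's statement VERBATIM is discharged from `IRCentreBlindNSC` alone, and that cut then concludes the
route decl from the pair (`OnsetMixingTypicalUKPcSC`, `AFToOnsetUKPc`; `stub_typCriterionUc` is the LANDED theorem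
p524017) + `IRCentreBlindNSC` (SC branch = the superseded slot's `irCal_of_pincerUcSC` proof body).  Declarations
byte-identical to v3∕v4; the check against the slot OF RECORD is §4♯ below.  Nothing here touches either slot. -/

namespace Summit.QuantumFields.YangMills.Cruxes.IR.AfPincerUc.CentreCover

/-- The registered residual `stub_irNSC`, statement VERBATIM (it is `ColdPressurePincer.IRnsc` unfolded), from
`IRCentreBlindNSC` ALONE (the cover is a theorem). -/
theorem stub_irNSC_of_centreCover (hcb : CentreCover.IRCentreBlindNSC) :
    ∀ (G : Type) [Group G] [TopologicalSpace G] [IsTopologicalGroup G] [CompactSpace G],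
      IsCompactSimpleLieGroup G → ¬ SimplyConnectedSpace G →
      letI : MeasurableSpace G := borel G; haveI : BorelSpace G := ⟨rfl⟩;
      ∀ (r : LatticeRep G) (a : ℝ → ℝ), (∀ β, 0 < a β) → Tendsto a atTop (𝓝 0) →
        LowerBounds G r a → GapInUnits G r a :=
  CentreCover.irnsc_of_centreBlindNSC hcb

/-- **The owner's SC branch: `I^c_SC → X^c → IRsc`** (`E^c` = the landed `stub_typCriterionUc`, p524017; proof body =
the SC case of the slot's `irCal_of_pincerUcSC`, verbatim). -/
theorem irsc_of_pincerUcSC (hI : OnsetFormatsUc.OnsetMixingTypicalUKPcSC) (hX : AFToOnsetUKPc) : IRsc := by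
  have hE : TypCriterionUKPc := stub_typCriterionUc  -- LANDED p524017 (S1)
  intro G _ _ _ _ hG hsc
  letI : MeasurableSpace G := borel G
  haveI : BorelSpace G := ⟨rfl⟩
  intro r a ha ha0 hlb
  obtain ⟨n, ε, hn, hε, hM, hIδ⟩ := hI G hG hsc r
  obtain ⟨δ₀, κ, s₀, hδ₀, hκ, hcl⟩ := fmtClustering_of_typCriterionUKPc hE r hn hε hM
  obtain ⟨β₂, hon⟩ := hIδ δ₀ hδ₀
  obtain ⟨T, β₆, hpin⟩ :=
    fmtOnset_pinned (fun β' b => TypShellCondUKPc r.ρ β' b n ε δ₀) r a ha hlb (hX G hG r n ε hn hε hM δ₀ hδ₀)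
  exact gapInUnits_of_fmtOnset r a ha hκ hcl
    (fun β hβ => by
      obtain ⟨b, hb, hP⟩ := hon β hβ
      exact ⟨b, hb, (typShellCondUKPc_iff_mirror r.ρ β b n ε δ₀).mpr hP⟩) hpin

/-- **… concluding the ROUTE DECL by name** from three named OPEN hypotheses, all of them statements about lattice gauge
theories — two on simply connected groups with faithful representations (`I^c_SC`, `X^c`), one on simply connected groups
with centre-blind representations (`IRCentreBlindNSC`); `sorry`-free. -/
theorem IR_of_pincerUcSC_centreCover (hI : OnsetFormatsUc.OnsetMixingTypicalUKPcSC)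
    (hX : AFToOnsetUKPc) (hcb : CentreCover.IRCentreBlindNSC) :
    Summit.QuantumFields.YangMills.Theses.BalabanLadder.IR :=
  IR_of_cases (irsc_of_pincerUcSC hI hX) (stub_irNSC_of_centreCover hcb)

end Summit.QuantumFields.YangMills.Cruxes.IR.AfPincerUc.CentreCover

/-! ## §4♯ Slot check against the slot OF RECORD «sharp merge I♯_SC» (`line-af-pincer-Uc.sharp.reg.lean`, 28967a1bf60ad397,
owner R104 ∕ REGISTRY WRITE #8; namespace `…Cruxes.IR.AfPincerUcSharp`, stubs `stub_onsetSharpSC : SharpOnset.OnsetSharpUKPcSC`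
(open) and `stub_irNSC : SharpOnset.IRNSC` (residual, unstaffed R101), composition `IR_of_sharp`): the registered residual
BY NAME is `ColdPressurePincer.IRnsc` on the nose (`Iff.rfl`), hence discharged from `IRCentreBlindNSC` alone, and the slot's
one open SC stub plus `IRCentreBlindNSC` conclude the route decl through the LANDED `SharpOnset.ir_of_onsetSharpSC` (p532238,
E = p524017 discharged inside).  Declared in the SUB-namespace `…AfPincerUcSharp.CentreCover`; nothing touches the slot. -/

namespace Summit.QuantumFields.YangMills.Cruxes.IR.AfPincerUcSharp.CentreCover

/-- Junction of record: the sharp slot's residual constant `AfPincerUc.SharpOnset.IRNSC` IS the `π₁`-split's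
`ColdPressurePincer.IRnsc` (same text; `𝓝 0` = `nhds 0`). -/
theorem irNSC_iff_irnsc : AfPincerUc.SharpOnset.IRNSC ↔ IRnsc :=
  Iff.rfl

/-- The registered residual `stub_irNSC : AfPincerUc.SharpOnset.IRNSC` of the slot of record, BY NAME, from
`IRCentreBlindNSC` ALONE (the cover is a theorem; §3 `irnsc_of_centreBlindNSC` read through `irNSC_iff_irnsc`). -/
theorem stub_irNSC_of_centreCover (hcb : CentreCover.IRCentreBlindNSC) : AfPincerUc.SharpOnset.IRNSC :=
  irNSC_iff_irnsc.mpr (CentreCover.irnsc_of_centreBlindNSC hcb)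

/-- **The slot of record's cut with the residual replaced by the centre-blind clause: I♯_SC → IRCentreBlindNSC → IR**,
concluding the ROUTE DECL by name from two named OPEN hypotheses, both statements about lattice gauge theories with SIMPLY
CONNECTED structure group — sharp typical onset for faithful representations (`stub_onsetSharpSC`'s type) and the crux clause for
centre-blind representations (`IRCentreBlindNSC`) — through the landed `AfPincerUc.SharpOnset.ir_of_onsetSharpSC`; `sorry`-free. -/
theorem IR_of_sharpSC_centreCover (hS : AfPincerUc.SharpOnset.OnsetSharpUKPcSC) (hcb : CentreCover.IRCentreBlindNSC) :
    Summit.QuantumFields.YangMills.Theses.BalabanLadder.IR :=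
  AfPincerUc.SharpOnset.ir_of_onsetSharpSC hS (stub_irNSC_of_centreCover hcb)

end Summit.QuantumFields.YangMills.Cruxes.IR.AfPincerUcSharp.CentreCover

end
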